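import Summits.BirchSwinnertonDyer.BirchSwinnertonDyer.Theorems.TwoAdicConverseOrdLambdaHalfAtTwoGreenbergGL1Reduction
import Summits.BirchSwinnertonDyer.BirchSwinnertonDyer.Theorems.UniversalToricDescentSigmaPassage
import Summits.BirchSwinnertonDyer.BirchSwinnertonDyer.Theorems.EisensteinPrimesSelmerAcQuotientCorankLeGeneric
import HarnessLib

/-!
# Route `TwoAdicConverse` (rung S3), crux `OrdLambdaHalfAtTwo` (item stmt-BirchSwinnertonDyer-19556), line
# `kato-determinant-greenberg-two`: the TAME input [P23] of the `GL(1)` residual stub is a KERNEL THEOREM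

Cell `bsd-2adic`, seat `bsd-2adic-conv-1` GEN 25 (`--supports` stmt-BirchSwinnertonDyer-19556; helper; pen RC-310 (4b)).
Sixth file of the B2 spine.  `…GreenbergGL1Reduction` (p661729) reduced the registered stub `stub_residualGL1FinitenessAtTwo`
(«`R_w^Σ(K_∞, M) = datumStrictSelmer (ker κ) M 2 (bdpData M 2 w) Σ` finite») to [P1] (everywhere-unramified classes finite —
Ferrero–Washington, PRINT) ∧ [P23] (for `v ∈ Σ`, `v ∤ p`: `H¹(ker κ, M)` modulo the classes unramified at every place above `v`
is finite) ∧ [C] (the `w̄`-step).  RC-310 priced [P23] as a PRINT fact (tame inertia + finite decomposition).  This file PROVES it,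
for ANY `ℤ_p`-extension `κ` of ANY number field, ANY finite discrete `Γ_K`-module `M` of `p`-power order with TRIVIAL action, and
ANY place `v ∤ p` whose decomposition group is not inside `ker κ` (finitely decomposed; automatic for the cyclotomic tower,
`not_decomp_le_kerSubgroup_of_isCyclotomic` p659144), by assembling tree theorems of the routes `UniversalToricDescent` /
`EisensteinPrimes` (cells `bsd-wall`, `bsd-eis`):

* `finite_subgroupH1_inf_decomp_of_trivial` — `H¹(ker κ ⊓ D_v, M)` is finite: the local group `Gal(K̄_v/K_{∞,η})` surjects onto
  `ker κ ⊓ D_v` and `H¹(Gal(K̄_v/K_{∞,η}), M)` is finite by the tree's prime-to-`p` tower theorem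
  `Iwasawa.NonsplitTower.finite_subgroupH1_and_natCard_le` (`#M = p^k` prime to the residue characteristic; the `ℤ_p`-tower over
  `K_v` is pro-`p` over a tamely ramified base), inflation along a surjection being injective (`Iwasawa.resH1Hom_injective_of_surjective`)
  — verbatim the pattern of `UniversalToricDescentSigmaPassage.finite_subgroupH1_inf_decomp_geomTorsion` (there for `E[p]`);
* **`finite_quotient_iInf_unramifiedKer_of_not_decomp_le`** = [P23]: `H¹(ker κ, M) ⧸ ⨅_σ conj_σ⁻¹(unramifiedKer v)` is finite —
  the signature `y ↦ (res_{ker κ ⊓ D_v} conj_{τ i} y)_{i < p^c}` (`τ i` representatives with `κ(τ i) = i`,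
  `UniversalToricDescentResidualSelmerFinite.forall_resOfLe_conjH1_eq_zero_of_reps`) has finite target and its kernel is LOCALLY
  TRIVIAL at every place above `v`, hence unramified there (`SelmerAcQuotientCorankLeGeneric.awayKer_le_unramifiedKer`);
* `finite_datumStrictSelmer_bdpData_of_P1_of_C` — hence the registered stub's finiteness ⟸ [P1] ∧ [C] alone once every `v ∈ Σ`
  prime to `p` is finitely decomposed, and `…_cyclotomic_of_P1_of_C` for the cyclotomic tower (no decomposition hypothesis);
* `greenbergStrictSelmerDual_finite_torsion_mu_on_beta_of_P1_of_C` — B2 on habitat (β) from [P1] ∧ [C] (composes p661101/p661729).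

HONEST FRAMING.  Composition of tree theorems; no definition, no named fact, no `sorry`; [P1] (Iwasawa `μ = 0` in character form,
proposal p662555 `classicalMuVanishes_finite_unramifiedClasses` + `ferreroWashington1979_classicalMuVanishes`) and [C] (the `w̄`-step,
NOTE-19556-GL1res-conv1-g25 §1(a)) remain displayed hypotheses; BSD is not proved by any of this.
PARTITION (D-0054): none — RANK axis S3 × X5@2 stratum (β); types-the-object-of (discharges the tame input of stub 3b).

References: R. Greenberg, LNM 1716 (1999) §3 Lemma 3.3 [GreenbergLNM1716]; R. Greenberg, V. Vatsal, Invent. Math. 142 (2000) §2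
Prop. (2.4) [GreenbergVatsal2000]; J.-P. Serre, *Corps locaux* IV §2; A. Fröhlich in Cassels–Fröhlich Ch. I §8 Thm 1, Cor. 3
[CasselsFrohlich1967].
-/

set_option linter.dupNamespace false
set_option autoImplicit false

noncomputable section

open scoped Classical

namespace Summit.BirchSwinnertonDyer.BirchSwinnertonDyer.Theorems.TwoAdicGreenbergCotorsion

open NumberField IsDedekindDomain Field WeierstrassCurve
open Literature.NumberTheory.EllipticCurves Literature.NumberTheory.EllipticCurves.GreenbergSelmer
  Literature.NumberTheory.EllipticCurves.GreenbergVatsal2000 Literature.NumberTheory.GaloisRepresentations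
  Summit.BirchSwinnertonDyer.Rank1Residual.X11b Summit.BirchSwinnertonDyer.Rank1Residual.X11b.AcSelmer
  Summit.BirchSwinnertonDyer.Rank1Residual.X2.ResidualDevissageModules
  Summit.BirchSwinnertonDyer.Rank1Residual.Iwasawa
  Summit.BirchSwinnertonDyer.BirchSwinnertonDyer.Theorems.UniversalToricDescentResidualSelmerFinite
  Summit.BirchSwinnertonDyer.BirchSwinnertonDyer.Theorems.SelmerAcQuotientCorankLeGeneric

/-! ## §1 `H¹(ker κ ⊓ D_v, M)` is finite for a trivial finite `p`-group `M` at a finitely decomposed `v ∤ p` -/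

section Local

variable {K : Type} [Field K] [NumberField K] {p : ℕ} [Fact p.Prime] (κ : ZpExtension K p)
  (M : Type) [AddCommGroup M] [DistribMulAction (absoluteGaloisGroup K) M] [TopologicalSpace M] [DiscreteTopology M]

/-- **`H¹(Gal(K̄/K_∞) ⊓ D_v, M)` is finite** for a finite discrete `Γ_K`-module `M` of `p`-power order with trivial action, at a
place `v ∤ p` whose decomposition group is not contained in `ker κ`.  The local group `Gal(K̄_v/K_{∞,η})` surjects onto
`ker κ ⊓ D_v`; on it `H¹(·, M)` is finite by the tree's prime-to-`p` tower theorem (`Iwasawa.NonsplitTower.finite_subgroupH1_and_natCard_le`: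
`#M` is prime to the residue characteristic), and inflation along a surjection is injective.
[cite: GreenbergLNM1716, §3 Lemma 3.3 (proof, p. 87)] [cite: GreenbergVatsal2000, §2 Prop. (2.4)] -/
theorem finite_subgroupH1_inf_decomp_of_trivial [Finite M] (hM : ∃ k : ℕ, Nat.card M = p ^ k)
    (htriv : ∀ (σ : absoluteGaloisGroup K) (m : M), σ • m = m)
    {v : HeightOneSpectrum (𝓞 K)} (hpv : (p : 𝓞 K) ∉ v.asIdeal) (hv : ¬ (decomp v ≤ κ.kerSubgroup)) :
    Finite (Literature.NumberTheory.EllipticCurves.subgroupH1 (κ.kerSubgroup ⊓ decomp v) M) := by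
  have hp : p.Prime := Fact.out
  -- the local action through the chosen embedding (a local instance of this proof only); trivial, hence continuous
  letI : DistribMulAction (absoluteGaloisGroup (v.adicCompletion K)) M :=
    DistribMulAction.compHom _ (absGaloisRestrict K (v.adicCompletion K)).toMonoidHom
  have hcont : ∀ b : M, Continuous fun σ : absoluteGaloisGroup (v.adicCompletion K) ↦ σ • b := fun b ↦ by
    have : (fun σ : absoluteGaloisGroup (v.adicCompletion K) ↦ σ • b) = fun _ ↦ b :=
      funext fun σ ↦ htriv (absGaloisRestrict K (v.adicCompletion K) σ) b
    rw [this]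
    exact continuous_const
  -- `v` not split completely: some `σ ∈ Γ_{K_v}` restricts outside `ker κ`
  have hns : ∃ σ : absoluteGaloisGroup (v.adicCompletion K),
      σ ∉ localSubgroup κ.kerSubgroup (v.adicCompletion K) := by
    by_contra hall
    refine hv fun g hg ↦ ?_
    obtain ⟨σ, rfl⟩ := (mem_decomp_iff v g).mp hg
    have hσ : σ ∈ localSubgroup κ.kerSubgroup (v.adicCompletion K) :=
      not_not.mp fun h ↦ hall ⟨σ, h⟩
    have h := (mem_localSubgroup_iff κ.kerSubgroup (v.adicCompletion K) σ).mp hσ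
    rwa [resGal_eq_absGaloisRestrict] at h
  -- `#M = p^k` is prime to the residue characteristic; `M` is `p^k`-torsion
  obtain ⟨k, hk⟩ := hM
  have hℓ := ringChar_residueField_prime (F := v.adicCompletion K)
  have hne := v.ringChar_residueField_adicCompletion_ne hpv
  have hB : ∃ k : ℕ, ∀ b : M, p ^ k • b = 0 := ⟨k, fun b ↦ by rw [← hk]; exact card_nsmul_eq_zero'⟩
  have hfin := (NonsplitTower.finite_subgroupH1_and_natCard_le κ hpv hns hB (by
    rw [hk]
    exact ((Nat.coprime_primes hp hℓ).2 (Ne.symm hne)).pow_left k) hcont).1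
  -- inflation along `Gal(K̄_v/K_{∞,η}) ↠ ker κ ⊓ D_v`
  let θ : localSubgroup κ.kerSubgroup (v.adicCompletion K) →ₜ* (κ.kerSubgroup ⊓ decomp v :
      Subgroup (absoluteGaloisGroup K)) :=
    { toFun := fun x ↦ ⟨absGaloisRestrict K (v.adicCompletion K) x, Subgroup.mem_inf.mpr ⟨by
          have h := (mem_localSubgroup_iff κ.kerSubgroup (v.adicCompletion K) x.1).mp x.2
          rwa [resGal_eq_absGaloisRestrict] at h, (mem_decomp_iff v _).mpr ⟨x, rfl⟩⟩⟩
      map_one' := Subtype.ext (by simp)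
      map_mul' := fun x y ↦ Subtype.ext (by simp)
      continuous_toFun :=
        ((absGaloisRestrict K (v.adicCompletion K)).continuous_toFun.comp
          continuous_subtype_val).subtype_mk _ }
  have hθ : Function.Surjective θ := by
    rintro ⟨g, hg⟩
    obtain ⟨hgH, hgD⟩ := Subgroup.mem_inf.mp hg
    obtain ⟨σ, rfl⟩ := (mem_decomp_iff v g).mp hgD
    have hσ : σ ∈ localSubgroup κ.kerSubgroup (v.adicCompletion K) := by
      rw [mem_localSubgroup_iff, resGal_eq_absGaloisRestrict]; exact hgH
    exact ⟨⟨σ, hσ⟩, rfl⟩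
  exact Finite.of_injective _ (resH1Hom_injective_of_surjective θ hθ fun _ _ ↦ rfl)

/-! ## §2 [P23]: the classes modulo «unramified at every place above `v`» form a finite group -/

/-- **[P23] is a theorem.**  For a `ℤ_p`-extension `κ` of a number field `K`, a place `v ∤ p` with `D_v ⊄ ker κ` (finitely
decomposed in `K_∞`), and a finite discrete `Γ_K`-module `M` of `p`-power order with trivial action:
`H¹(ker κ, M) ⧸ ⨅_σ conj_σ⁻¹(unramifiedKer (ker κ) M v)` is FINITE.  Proof: with representatives `τ i`, `κ(τ i) = i`
(`i < p^c`, `forall_resOfLe_conjH1_eq_zero_of_reps`), the signature `y ↦ (res_{ker κ ⊓ D_v} conj_{τ i} y)_{i<p^c}` has the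
finite target `(H¹(ker κ ⊓ D_v, M))^{p^c}` (§1); its kernel is locally trivial at EVERY place above `v` (all conjugates),
hence unramified there (`awayKer_le_unramifiedKer`), i.e. contained in the infimum; a subgroup containing a finite-index
subgroup has finite index. [cite: GreenbergVatsal2000, §2 Prop. (2.4)] [cite: CasselsFrohlich1967, Ch. I §8 Thm. 1, Cor. 3] -/
theorem finite_quotient_iInf_unramifiedKer_of_not_decomp_le [Finite M] (hM : ∃ k : ℕ, Nat.card M = p ^ k)
    (htriv : ∀ (σ : absoluteGaloisGroup K) (m : M), σ • m = m)
    {v : HeightOneSpectrum (𝓞 K)} (hpv : (p : 𝓞 K) ∉ v.asIdeal) (hv : ¬ (decomp v ≤ κ.kerSubgroup)) :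
    Finite (Literature.NumberTheory.EllipticCurves.subgroupH1 κ.kerSubgroup M ⧸
      ⨅ σ : absoluteGaloisGroup K, (unramifiedKer κ.kerSubgroup M v).comap
        (Literature.NumberTheory.EllipticCurves.conjH1 κ.kerSubgroup M σ)) := by
  haveI := finite_subgroupH1_inf_decomp_of_trivial κ M hM htriv hpv hv
  set U : AddSubgroup (Literature.NumberTheory.EllipticCurves.subgroupH1 κ.kerSubgroup M) :=
    ⨅ σ : absoluteGaloisGroup K, (unramifiedKer κ.kerSubgroup M v).comap
      (Literature.NumberTheory.EllipticCurves.conjH1 κ.kerSubgroup M σ)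
  obtain ⟨c, hc⟩ := forall_resOfLe_conjH1_eq_zero_of_reps (κ := κ) (M := M) v hv
  -- representatives `τ i` with `κ (τ i) = i`
  have hτ' : ∀ i : ℕ, ∃ τ : absoluteGaloisGroup K, κ τ = Multiplicative.ofAdd ((i : ℕ) : ℤ_[p]) :=
    fun i ↦ κ.surjective _
  choose τ hτ using hτ'
  -- the signature map
  let res := resOfLe M (inf_le_left : κ.kerSubgroup ⊓ decomp v ≤ κ.kerSubgroup)
  let Ψ : Literature.NumberTheory.EllipticCurves.subgroupH1 κ.kerSubgroup M →+
      (Fin (p ^ c) → Literature.NumberTheory.EllipticCurves.subgroupH1 (κ.kerSubgroup ⊓ decomp v) M) :=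
    AddMonoidHom.pi fun i ↦ res.comp (Literature.NumberTheory.EllipticCurves.conjH1 κ.kerSubgroup M (τ i))
  -- its kernel is unramified at every place above `v`
  have hker : Ψ.ker ≤ U := by
    intro y hy
    rw [AddMonoidHom.mem_ker] at hy
    have hy' : ∀ i, i < p ^ c →
        res (Literature.NumberTheory.EllipticCurves.conjH1 κ.kerSubgroup M (τ i) y) = 0 := fun i hi ↦
      congrFun hy ⟨i, hi⟩
    have hall := hc τ hτ y hy'
    simp only [U, AddSubgroup.mem_iInf, AddSubgroup.mem_comap]
    intro σ
    exact awayKer_le_unramifiedKer κ.kerSubgroup M v ((AddMonoidHom.mem_ker).mpr (hall σ))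
  -- finite index
  haveI : Finite (Literature.NumberTheory.EllipticCurves.subgroupH1 κ.kerSubgroup M ⧸ Ψ.ker) :=
    Finite.of_injective (QuotientAddGroup.kerLift Ψ) (QuotientAddGroup.kerLift_injective Ψ)
  haveI : Ψ.ker.FiniteIndex := AddSubgroup.finiteIndex_of_finite_quotient
  haveI : U.FiniteIndex := AddSubgroup.finiteIndex_of_le hker
  exact AddSubgroup.finite_quotient_of_finiteIndex

end Local

/-! ## §3 The registered stub's finiteness and B2 on (β) from [P1] ∧ [C] -/

section Assembly

variable {K : Type} [Field K] [NumberField K] {p : ℕ} [Fact p.Prime] (κ : ZpExtension K p)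
  (M : Type) [AddCommGroup M] [DistribMulAction (absoluteGaloisGroup K) M] [TopologicalSpace M] [DiscreteTopology M]
  (w : HeightOneSpectrum (𝓞 K)) (hw : ((p : ℕ) : 𝓞 K) ∈ w.asIdeal) (S : Set (HeightOneSpectrum (𝓞 K)))

/-- **`R_w^Σ(K_∞, M)` finite from [P1] ∧ [C]** when every `v ∈ Σ` prime to `p` is finitely decomposed in `K_∞` (the tame input [P23]
discharged by `finite_quotient_iInf_unramifiedKer_of_not_decomp_le`); `M` a finite discrete `Γ_K`-module of `p`-power order with
trivial action, `Σ` finite. [cite: JaulentMaire2003, Thm 12 and Example p. 189] [cite: GreenbergVatsal2000, §2 Prop. (2.4)] -/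
theorem finite_datumStrictSelmer_bdpData_of_P1_of_C [Finite M] (hM : ∃ k : ℕ, Nat.card M = p ^ k)
    (htriv : ∀ (σ : absoluteGaloisGroup K) (m : M), σ • m = m) (hSfin : S.Finite)
    (hSdec : ∀ v ∈ S, ((p : ℕ) : 𝓞 K) ∉ v.asIdeal → ¬ (decomp v ≤ κ.kerSubgroup))
    (hP1 : {c : Literature.NumberTheory.EllipticCurves.subgroupH1 κ.kerSubgroup M |
      ∀ (v : HeightOneSpectrum (𝓞 K)) (σ : absoluteGaloisGroup K),
        Literature.NumberTheory.EllipticCurves.conjH1 κ.kerSubgroup M σ c ∈ unramifiedKer κ.kerSubgroup M v}.Finite)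
    (hC : ∀ c : Literature.NumberTheory.EllipticCurves.subgroupH1 κ.kerSubgroup M,
      c ∈ unramifiedOutside κ.kerSubgroup M p ∅ →
      (∀ σ : absoluteGaloisGroup K, Literature.NumberTheory.EllipticCurves.conjH1 κ.kerSubgroup M σ c ∈
        (AcSelmer.bdpData M p w w hw).strictKer κ.kerSubgroup) →
      ∀ (v : HeightOneSpectrum (𝓞 K)), ((p : ℕ) : 𝓞 K) ∈ v.asIdeal →
        ∀ σ : absoluteGaloisGroup K,
          Literature.NumberTheory.EllipticCurves.conjH1 κ.kerSubgroup M σ c ∈ unramifiedKer κ.kerSubgroup M v) :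
    (datumStrictSelmer κ.kerSubgroup M p (AcSelmer.bdpData M p w) S :
      Set (Literature.NumberTheory.EllipticCurves.subgroupH1 κ.kerSubgroup M)).Finite :=
  finite_datumStrictSelmer_bdpData_of_inputs κ.kerSubgroup M p w hw S hSfin hP1
    (fun v hv hpv ↦ finite_quotient_iInf_unramifiedKer_of_not_decomp_le κ M hM htriv hpv (hSdec v hv hpv)) hC

/-- **The cyclotomic case**: over the CYCLOTOMIC `ℤ_p`-tower every finite place is finitely decomposed
(`not_decomp_le_kerSubgroup_of_isCyclotomic`, p659144), so `R_w^Σ(K_∞, M)` is finite from [P1] ∧ [C] with no decomposition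
hypothesis — the shape of the registered stub `stub_residualGL1FinitenessAtTwo` (`p = 2`, `#M = 2`, `K` imaginary quadratic).
[cite: JaulentMaire2003, Thm 12 and Example p. 189] [cite: Washington1997, §13.1] -/
theorem finite_datumStrictSelmer_bdpData_cyclotomic_of_P1_of_C [Finite M] (hM : ∃ k : ℕ, Nat.card M = p ^ k)
    (htriv : ∀ (σ : absoluteGaloisGroup K) (m : M), σ • m = m) (hκ : κ.IsCyclotomic) (hSfin : S.Finite)
    (hP1 : {c : Literature.NumberTheory.EllipticCurves.subgroupH1 κ.kerSubgroup M |
      ∀ (v : HeightOneSpectrum (𝓞 K)) (σ : absoluteGaloisGroup K),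
        Literature.NumberTheory.EllipticCurves.conjH1 κ.kerSubgroup M σ c ∈ unramifiedKer κ.kerSubgroup M v}.Finite)
    (hC : ∀ c : Literature.NumberTheory.EllipticCurves.subgroupH1 κ.kerSubgroup M,
      c ∈ unramifiedOutside κ.kerSubgroup M p ∅ →
      (∀ σ : absoluteGaloisGroup K, Literature.NumberTheory.EllipticCurves.conjH1 κ.kerSubgroup M σ c ∈
        (AcSelmer.bdpData M p w w hw).strictKer κ.kerSubgroup) →
      ∀ (v : HeightOneSpectrum (𝓞 K)), ((p : ℕ) : 𝓞 K) ∈ v.asIdeal →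
        ∀ σ : absoluteGaloisGroup K,
          Literature.NumberTheory.EllipticCurves.conjH1 κ.kerSubgroup M σ c ∈ unramifiedKer κ.kerSubgroup M v) :
    (datumStrictSelmer κ.kerSubgroup M p (AcSelmer.bdpData M p w) S :
      Set (Literature.NumberTheory.EllipticCurves.subgroupH1 κ.kerSubgroup M)).Finite :=
  finite_datumStrictSelmer_bdpData_of_P1_of_C κ M w hw S hM htriv hSfin
    (fun v _ _ ↦ not_decomp_le_kerSubgroup_of_isCyclotomic κ hκ v) hP1 hC

end Assembly

section B2

variable (W : WeierstrassCurve ℚ) [W.IsElliptic] {K : Type} [Field K] [NumberField K]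

/-- **B2 ON HABITAT (β) FROM [P1] ∧ [C]** (the tame input now a theorem).  As
`greenbergStrictSelmerDual_finite_torsion_mu_on_beta_of_inputs` (p661729) without the hypothesis `hP23`; `Σ` finite (the bad places of
`E_K` prime to `2`), `κ` cyclotomic.  For each stable line `Φ ≤ E_K[2]` the module `Φ.Sub` has order `2` and trivial action
(`smul_eq_self_of_natCard_eq_two`). [cite: CastellaGrossiLeeSkinner2022, §1.4 Props. 17–18] [cite: JaulentMaire2003, Thm 12 and Example p. 189] -/
theorem greenbergStrictSelmerDual_finite_torsion_mu_on_beta_of_P1_of_C (hred : ¬ W.HasIrreducibleModPGaloisRep 2)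
    (κ : ZpExtension K 2) (hκ : κ.IsCyclotomic) {γ : absoluteGaloisGroup K} (hγ : κ.IsTopGenerator γ)
    {w : HeightOneSpectrum (𝓞 K)} (hw : ((2 : ℕ) : 𝓞 K) ∈ w.asIdeal)
    {S : Set (HeightOneSpectrum (𝓞 K))} (hSfin : S.Finite)
    (hS : ∀ v : HeightOneSpectrum (𝓞 K), v ∉ S → ((2 : ℕ) : 𝓞 K) ∉ v.asIdeal → (W.baseChange K).HasGoodReductionAt v)
    (hP1 : ∀ Φ : StableSubgroup (absoluteGaloisGroup K) ((W.baseChange K).geomTorsion (2 : ℤ)), Nat.card Φ.Sub = 2 →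
      {c : Literature.NumberTheory.EllipticCurves.subgroupH1 κ.kerSubgroup Φ.Sub |
        ∀ (v : HeightOneSpectrum (𝓞 K)) (σ : absoluteGaloisGroup K),
        Literature.NumberTheory.EllipticCurves.conjH1 κ.kerSubgroup Φ.Sub σ c ∈ unramifiedKer κ.kerSubgroup Φ.Sub v}.Finite)
    (hC : ∀ Φ : StableSubgroup (absoluteGaloisGroup K) ((W.baseChange K).geomTorsion (2 : ℤ)), Nat.card Φ.Sub = 2 →
      ∀ c : Literature.NumberTheory.EllipticCurves.subgroupH1 κ.kerSubgroup Φ.Sub,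
        c ∈ unramifiedOutside κ.kerSubgroup Φ.Sub 2 ∅ →
        (∀ σ : absoluteGaloisGroup K, Literature.NumberTheory.EllipticCurves.conjH1 κ.kerSubgroup Φ.Sub σ c ∈
          (AcSelmer.bdpData Φ.Sub 2 w w hw).strictKer κ.kerSubgroup) →
        ∀ (v : HeightOneSpectrum (𝓞 K)), ((2 : ℕ) : 𝓞 K) ∈ v.asIdeal →
          ∀ σ : absoluteGaloisGroup K,
            Literature.NumberTheory.EllipticCurves.conjH1 κ.kerSubgroup Φ.Sub σ c ∈ unramifiedKer κ.kerSubgroup Φ.Sub v)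
    (D : (W.baseChange K).GreenbergStrictSelmerDualData κ γ (AcSelmer.bdpData _ 2 w)) :
    Module.Finite (IwasawaAlgebra 2) D.X ∧ Module.IsTorsion (IwasawaAlgebra 2) D.X ∧ muInvariant 2 D.X = 0 := by
  haveI : Fact (Nat.Prime 2) := ⟨Nat.prime_two⟩
  refine greenbergStrictSelmerDual_finite_torsion_mu_on_beta_of_GL1 W hred κ hκ hγ hw hS (fun Φ hΦ2 ↦ ?_) D
  haveI : Finite Φ.Sub := Nat.finite_of_card_ne_zero (by rw [hΦ2]; norm_num)
  exact finite_datumStrictSelmer_bdpData_cyclotomic_of_P1_of_C κ Φ.Sub w hw S ⟨1, by rw [hΦ2, pow_one]⟩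
    (fun σ m ↦ smul_eq_self_of_natCard_eq_two hΦ2 σ m) hκ hSfin (hP1 Φ hΦ2) (hC Φ hΦ2)

end B2

end Summit.BirchSwinnertonDyer.BirchSwinnertonDyer.Theorems.TwoAdicGreenbergCotorsion

end
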